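import Summits.Ventures.CertifiedManyBodySolver.Theorems.TcThermcert1FugacityProjection
import Summits.Ventures.CertifiedManyBodySolver.Theorems.TcThermcert1FreeGasCurrentCovariance
import HarnessLib

/-!
# Free canonical gas at `β·t = 8` — the Darwin–Fowler projection identity WITH an insertion

Helper file for route `TcThermcert1` (crux K1′ `ThermalStiffnessCeilingU8b8_le_7o44`, item `stmt-Ventures-24560`), crux idea
`free-canonical-b8-rung`. The scheme's starting point is the sector trace with an INSERTION written as a coefficient integral of the
complex two-fugacity trace: for EVERY matrix `Y` on the Fock space (intended: `Y = e^{−βH₀} · A j`),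

  `tr(P_{a,b} Y) = (2π)⁻² ∬ tr( diag(ζ↑^{N↑} ζ↓^{N↓}) Y ) ζ↑^{−a} ζ↓^{−b} dφ dψ`,  `ζ↑ = r e^{iφ}`, `ζ↓ = r e^{iψ}`, any `r > 0`.

This is the tree's `trace_exp_neg_smul_toBlock_eq_torusIntegral` (`Theorems/TcThermcert1FugacityProjection.lean`, stated there for
the sector partition function only) with the exponential replaced by an arbitrary matrix: the sector projection `P_{a,b}` is a
diagonal indicator, so only diagonal entries of `Y` enter and the coefficient extraction `torusIntegral_finset_sum` applies verbatim.
Together with the dictionary `gibbsState_toBlock_eq_sectorTrace` (sector Gibbs state = projected trace / projected partition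
function) this puts the numerator `tr(P e^{−βH₀} A j)` of the line's `sectorExpect … (A * bondCurrent …)` on the fugacity torus, where
S1 (`fugacityTrace_current_eq_zero`) and the pull-through identities S5 (`fugacity_pullThrough_current_twoLeg`) act on the integrand.

HONEST LABEL: finite-dimensional algebra plus the circle orthogonality of monomials; a step of a RUNG (`U = 0`, BC5-type witness for
the C8 bet), reach at `U = 8` ZERO; decides nothing about K1/K1′/`T_c`; superconductivity in the Hubbard model is NOT proved or advanced
by this file beyond the rung.
-/

noncomputable section

namespace Summit.Ventures.CertifiedManyBodySolver.Theorems.TcThermcert1.FreeCanonicalB8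

open Matrix Finset Complex MeasureTheory intervalIntegral
open Literature.MathematicalPhysics.QuantumLattice
open Summit.Ventures.CertifiedManyBodySolver.Theorems.TcThermcert1.ZeroFreeCorridor

variable {Λ : Type*} [LinearOrder Λ] [Fintype Λ]

/-- `tr(P_{a,b} Y) = Σ_{s : #↑s = a, #↓s = b} Y_{ss}`: the sector projection is a diagonal indicator. -/
theorem trace_spinSectorProj_mul_eq_sum_ite (Y : Matrix (Finset (Orb Λ)) (Finset (Orb Λ)) ℂ) (a b : ℕ) :
    (spinSectorProj a b * Y).trace = ∑ s, if (upPart s).card = a ∧ (downPart s).card = b then Y s s else 0 := by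
  simp only [Matrix.trace, diag_apply, spinSectorProj, diagonal_mul, ite_mul, one_mul, zero_mul]

/-- **Darwin–Fowler projection with an insertion.** For every matrix `Y` on the Fock space, every sector `(a, b)` and every radius
`r > 0`: `tr(P_{a,b} Y) = (2π)⁻² ∬_{[0,2π]²} tr(diag((re^{iφ})^{N↑} (re^{iψ})^{N↓}) Y) / ((re^{iφ})^a (re^{iψ})^b) dψ dφ`.
(Free implicit `inst` for the `DecidableEq` instance of the occupation basis, as in the tree's `trace_diagonal_fugacity_mul`.) -/
theorem trace_spinSectorProj_mul_eq_torusIntegral {inst : DecidableEq (Finset (Orb Λ))}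
    (Y : Matrix (Finset (Orb Λ)) (Finset (Orb Λ)) ℂ) (a b : ℕ) {r : ℝ} (hr : 0 < r) :
    (spinSectorProj a b * Y).trace =
      ((2 * Real.pi : ℂ) ^ 2)⁻¹ * ∫ φ in (0 : ℝ)..2 * Real.pi, ∫ ψ in (0 : ℝ)..2 * Real.pi,
        (@diagonal _ ℂ inst _ (fun s : Finset (Orb Λ) =>
            ((r : ℂ) * cexp ((φ : ℂ) * I)) ^ (upPart s).card * ((r : ℂ) * cexp ((ψ : ℂ) * I)) ^ (downPart s).card) * Y).trace /
          (((r : ℂ) * cexp ((φ : ℂ) * I)) ^ a * ((r : ℂ) * cexp ((ψ : ℂ) * I)) ^ b) := by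
  rw [trace_spinSectorProj_mul_eq_sum_ite Y a b]
  simp_rw [trace_diagonal_fugacity_mul]
  rw [torusIntegral_finset_sum _ _ _ _ hr]

/-- **The canonical-sector Gibbs expectation on the fugacity torus.** For `H` conserving `N↑, N↓`, the sector `p = {#↑ = M, #↓ = N}`
and every observable `O`: `ω_p(O) = tr(P_{M,N} e^{−βH})⁻¹ · (2π)⁻² ∬ tr(diag(ζ↑^{N↑}ζ↓^{N↓}) e^{−βH} O) ζ↑^{−M} ζ↓^{−N}` (`|ζ| = r > 0`),
where `ω_p` is the compressed Gibbs state `gibbsState β H_p O_p` of the line's `sectorExpect` (canonical instances; callers with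
another `DecidableEq` instance use `convert`). -/
theorem sectorGibbs_eq_inv_mul_torusIntegral
    {H : Matrix (Finset (Orb Λ)) (Finset (Orb Λ)) ℂ} (hP : PreservesSectors H) (β : ℝ) {M N : ℕ}
    (p : Finset (Orb Λ) → Prop) [DecidablePred p] (hp : ∀ s, p s ↔ (upPart s).card = M ∧ (downPart s).card = N)
    (O : Matrix (Finset (Orb Λ)) (Finset (Orb Λ)) ℂ) {r : ℝ} (hr : 0 < r) :
    gibbsState β (H.toBlock p p) (O.toBlock p p) =
      ((spinSectorProj M N * gibbsWeight β H).trace)⁻¹ *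
        (((2 * Real.pi : ℂ) ^ 2)⁻¹ * ∫ φ in (0 : ℝ)..2 * Real.pi, ∫ ψ in (0 : ℝ)..2 * Real.pi,
          (diagonal (fun s : Finset (Orb Λ) =>
              ((r : ℂ) * cexp ((φ : ℂ) * I)) ^ (upPart s).card * ((r : ℂ) * cexp ((ψ : ℂ) * I)) ^ (downPart s).card) *
              (gibbsWeight β H * O)).trace /
            (((r : ℂ) * cexp ((φ : ℂ) * I)) ^ M * ((r : ℂ) * cexp ((ψ : ℂ) * I)) ^ N)) := by
  rw [Summit.Ventures.CertifiedManyBodySolver.Theorems.TcThermcert1.FreeGasCurrentClustering.gibbsState_toBlock_eq_sectorTrace hP β p hp,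
    Matrix.mul_assoc, trace_spinSectorProj_mul_eq_torusIntegral (inst := inferInstance) (gibbsWeight β H * O) M N hr]

end Summit.Ventures.CertifiedManyBodySolver.Theorems.TcThermcert1.FreeCanonicalB8

end
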